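import Summits.CriticalPhenomena.Ising3D.TaylorTableDecidable
import Summits.CriticalPhenomena.Ising3D.TaylorRegionCertsH
import HarnessLib

/-!
# The all-Boolean γ-capstone, hybrid-route region certificates
(cell `pub-ising3x`, seat recog-1 gen 11; gate (g2) — the one-line composition of boot-1 g6's
`TaylorTable.boxExcluded_of_taylorTable_dec` (`TaylorTableDecidable`: table check `T.check` AND coefficient
enclosures `T.checkEncl`, both Booleans) with recog-1 g11's HYBRID region certificates (`TaylorRegionCertsH`);
the kernel-route / exact-`(E, j)`-route twins `…_dec_of_certs` / `…_dec_of_certsEJ` are boot-1 g7's file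
`TaylorTableDecOfCerts`)

HONEST FRAMING: lottery ticket; floor = tightest certified 3D Ising CFT bounds; no exact-solution
claim without a proof. Island framing: certified exclusion region at stated derivative order and
assumptions; not a determination of the 3D Ising critical exponents beyond that.

**`TaylorTable.boxExcluded_of_taylorTable_dec_of_certsH`**:
`T.check = true → T.checkEncl = true → (T.evenCertH πE).check = true → (T.oddCertH πO).check = true → BoxExcluded T.box`
— no named real-analytic side condition per box is left: every hypothesis is `(_ : Bool) = true` on the table's own
rational data plus region parameters (`EvenRegionParamsH`, `OddConeParamsH`), each dischargeable by `decide +kernel`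
on a concrete table. The region side
is SUFFICIENT, not necessary (λ-averaged termwise conditions; integer `j` exact below `E₁`, real `θ = j/E` beyond;
interval slack) — see `TaylorRegionCheckHybrid`; for boxes of positive width instantiate the local-product form of
the even check (`TaylorRegionCheckHybridL`, measured necessity). Elementary glue. [folklore]
-/

namespace Summit.CriticalPhenomena.Ising3D

open Literature.MathematicalPhysics.QuantumFieldTheory.ConformalBootstrap3D

namespace TaylorTable

variable (T : TaylorTable)

/-- **All-Boolean capstone, hybrid-route region certificates**: the table check, the decidable coefficient
enclosures, and the two hybrid region certificates of the table (its own data plus parameters `πE`, `πO`) give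
`BoxExcluded T.box`. [folklore] -/
theorem boxExcluded_of_taylorTable_dec_of_certsH (h : T.check = true) (he : T.checkEncl = true)
    (πE : EvenRegionParamsH) (hE : (T.evenCertH πE).check = true)
    (πO : OddConeParamsH) (hO : (T.oddCertH πO).check = true) : BoxExcluded T.box :=
  T.boxExcluded_of_taylorTable_dec h he (T.evenRegion_of_evenCertH πE hE) (T.oddCone_of_oddCertH πO hO)

end TaylorTable

end Summit.CriticalPhenomena.Ising3D
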